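import Mathlib.RingTheory.Spectrum.Prime.Chevalley
import Mathlib.RingTheory.FinitePresentation
import HarnessLib

/-!
# Generic open image: a dominant morphism of finite presentation hits a dense basic open set

Topic `Literature/Computability/AlgebraicComplexity` (val-lit cell, row BLMW2011-B, brick A of
the route to `BLMW2011_lemma_9_4_1`, the Hilbert–Kraft curve lemma behind BLMW 2011 Lemma 9.4.1 /
Kraft 1984 III.2.3; see `HOME/bip/NOTE-t14g4-BLMW941-HilbertKraft-route.md`, step (A)).
Theorems only.

For an injective ring homomorphism `f : A → R` of finite presentation between integral domains
(a dominant morphism `Spec R → Spec A` of finite presentation), there is `c ≠ 0` in `A` such that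
every prime `𝔭` of `A` with `c ∉ 𝔭` is the contraction of a prime of `R` — the image of `Spec R`
contains the dense open `D(c)` (Atiyah–Macdonald Ch. 7 Ex. 23 / Stacks 00F8 with 053B:
Chevalley's theorem — the image is constructible, Mathlib
`PrimeSpectrum.isConstructible_range_comap` — and a constructible subset of an irreducible space
containing the generic point contains a non-empty open subset, Ch. 7 Ex. 20(ii)).
The proof here reads the constructible image off Mathlib's normal form
`PrimeSpectrum.exists_constructibleSetData_iff` (`⋃_C V(g_C) ∖ V(f_C)`): the piece containing the
generic point `(0) = f⁻¹(0)` has all `g_C = 0` and `f_C ≠ 0`, i.e. it is `D(f_C)`.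

* `PrimeSpectrum.exists_basicOpen_subset_range_comap` (points of `Spec A`);
* `Ideal.exists_forall_isPrime_comap_eq_of_finitePresentation` (ideal form);
* `Algebra.exists_forall_isPrime_comap_algebraMap_eq` (algebra form: `A` Noetherian, `R` of finite
  type over `A` — e.g. finitely generated algebras over a field — `algebraMap A R` injective).

Honest framing: textbook commutative algebra feeding a closure lemma of GCT; VP ≠ VNP is NOT
proved and nothing here bears on it.

## References

* [AtiyahMacdonald1969] M. F. Atiyah, I. G. Macdonald, *Introduction to Commutative Algebra*,
  Addison-Wesley 1969: Ch. 7, Exercise 23 (Chevalley: `f*` maps constructible sets to constructible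
  sets; its hint ends with exactly the present statement — `A ⊆ B` integral domains, `B` of finite
  type over `A`, then `f*(Spec B)` contains a non-empty open subset of `Spec A`), Ch. 7, Exercise
  20 (ii) (a constructible subset of an irreducible space is dense iff it contains a non-empty open
  set) and Ch. 5, Exercise 21 (the element `s ≠ 0`).
* [Kraft1984] H. Kraft, *Geometrische Methoden in der Invariantentheorie*, Vieweg 1984, III.2.3
  (the curve lemma this brick feeds; cited by BLMW 2011, Lemma 9.4.1).
* Stacks Project, Tag 00F8 (Chevalley) and Tag 053B (generic points under dominant morphisms of
  finite presentation).
-/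

namespace Literature.Computability.AlgebraicComplexity

open PrimeSpectrum

/-- **Generic open image.** If `f : A → R` is an injective ring homomorphism of finite presentation
between integral domains, then for some `c ≠ 0` in `A` every point of the basic open set `D(c)` of
`Spec A` is in the image of `Spec R → Spec A` (Chevalley's theorem + the generic point).
[cite: AtiyahMacdonald1969, Ch. 7 Ex. 23 (hint), with Ch. 7 Ex. 20(ii) and Ch. 5 Ex. 21] -/
theorem PrimeSpectrum.exists_basicOpen_subset_range_comap {A R : Type*} [CommRing A] [IsDomain A]
    [CommRing R] [IsDomain R] {f : A →+* R} (hf : f.FinitePresentation)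
    (hinj : Function.Injective f) :
    ∃ c : A, c ≠ 0 ∧ ∀ 𝔭 : PrimeSpectrum A, c ∉ 𝔭.asIdeal →
      ∃ 𝔮 : PrimeSpectrum R, PrimeSpectrum.comap f 𝔮 = 𝔭 := by
  classical
  -- Chevalley: the image is constructible, hence a finite union of `V(g_C) \ V(f_C)`
  obtain ⟨S, hS⟩ := PrimeSpectrum.exists_constructibleSetData_iff.mpr
    (PrimeSpectrum.isConstructible_range_comap hf)
  -- the generic point of `Spec A` is the image of the generic point of `Spec R`
  let ηR : PrimeSpectrum R := ⟨⊥, Ideal.isPrime_bot⟩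
  have hη : PrimeSpectrum.comap f ηR = (⟨⊥, Ideal.isPrime_bot⟩ : PrimeSpectrum A) := by
    ext x
    rw [PrimeSpectrum.comap_asIdeal]
    change x ∈ Ideal.comap f ⊥ ↔ x ∈ (⊥ : Ideal A)
    rw [← RingHom.ker_eq_comap_bot, (RingHom.injective_iff_ker_eq_bot f).mp hinj]
  have hmem : (⟨⊥, Ideal.isPrime_bot⟩ : PrimeSpectrum A) ∈ S.toSet := by
    rw [hS, ← hη]
    exact Set.mem_range_self _
  rw [ConstructibleSetData.toSet, Set.mem_iUnion₂] at hmem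
  obtain ⟨C, hCS, hC⟩ := hmem
  rw [BasicConstructibleSetData.toSet, Set.mem_sdiff, PrimeSpectrum.mem_zeroLocus,
    PrimeSpectrum.mem_zeroLocus, Set.singleton_subset_iff] at hC
  -- all `g_C` vanish and `f_C ≠ 0`
  have hg : ∀ i, C.g i = 0 := fun i =>
    (Submodule.mem_bot A).mp (hC.1 (Set.mem_range_self i))
  have hfC : C.f ≠ 0 := fun h0 => hC.2 (by
    change C.f ∈ (⊥ : Ideal A)
    rw [h0]
    exact Submodule.zero_mem _)
  refine ⟨C.f, hfC, fun 𝔭 h𝔭 => ?_⟩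
  -- `𝔭 ∈ D(f_C) = V(g_C) \ V(f_C) ⊆ range (comap f)`
  have h𝔭C : 𝔭 ∈ C.toSet := by
    rw [BasicConstructibleSetData.toSet, Set.mem_sdiff, PrimeSpectrum.mem_zeroLocus,
      PrimeSpectrum.mem_zeroLocus, Set.singleton_subset_iff]
    refine ⟨?_, h𝔭⟩
    rintro _ ⟨i, rfl⟩
    rw [hg i]
    exact Submodule.zero_mem _
  have : 𝔭 ∈ S.toSet := by
    rw [ConstructibleSetData.toSet, Set.mem_iUnion₂]
    exact ⟨C, hCS, h𝔭C⟩
  rw [hS] at this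
  exact this

/-- **Generic open image, ideal form**: for an injective ring homomorphism `f : A → R` of finite
presentation between integral domains there is `c ≠ 0` in `A` such that every prime ideal `𝔭` of
`A` with `c ∉ 𝔭` is the contraction `f⁻¹(𝔮)` of a prime ideal `𝔮` of `R`.
[cite: AtiyahMacdonald1969, Ch. 7 Ex. 23 (hint), with Ch. 7 Ex. 20(ii) and Ch. 5 Ex. 21] -/
theorem Ideal.exists_forall_isPrime_comap_eq_of_finitePresentation {A R : Type*} [CommRing A]
    [IsDomain A] [CommRing R] [IsDomain R] {f : A →+* R} (hf : f.FinitePresentation)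
    (hinj : Function.Injective f) :
    ∃ c : A, c ≠ 0 ∧ ∀ 𝔭 : Ideal A, 𝔭.IsPrime → c ∉ 𝔭 →
      ∃ 𝔮 : Ideal R, 𝔮.IsPrime ∧ 𝔮.comap f = 𝔭 := by
  obtain ⟨c, hc, h⟩ := PrimeSpectrum.exists_basicOpen_subset_range_comap hf hinj
  refine ⟨c, hc, fun 𝔭 h𝔭 hc𝔭 => ?_⟩
  obtain ⟨𝔮, h𝔮⟩ := h ⟨𝔭, h𝔭⟩ hc𝔭
  refine ⟨𝔮.asIdeal, 𝔮.isPrime, ?_⟩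
  rw [← PrimeSpectrum.comap_asIdeal, h𝔮]

/-- **Generic open image for algebras of finite type over a Noetherian domain** (the form used for
finitely generated algebras over a field: `A' ⊆ R` finitely generated `k`-domains, `R` being of
finite type over `A'`, which is Noetherian; finite type over a Noetherian ring is finite
presentation, Mathlib `Algebra.FinitePresentation.of_finiteType`): some `c ≠ 0` in `A` has every
prime of `A` avoiding it lifted to a prime of `R`.
[cite: AtiyahMacdonald1969, Ch. 7 Ex. 23 (hint), with Ch. 7 Ex. 20(ii) and Ch. 5 Ex. 21] -/
theorem Algebra.exists_forall_isPrime_comap_algebraMap_eq (A R : Type*) [CommRing A] [IsDomain A]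
    [IsNoetherianRing A] [CommRing R] [IsDomain R] [Algebra A R] [Algebra.FiniteType A R]
    (hinj : Function.Injective (algebraMap A R)) :
    ∃ c : A, c ≠ 0 ∧ ∀ 𝔭 : Ideal A, 𝔭.IsPrime → c ∉ 𝔭 →
      ∃ 𝔮 : Ideal R, 𝔮.IsPrime ∧ 𝔮.comap (algebraMap A R) = 𝔭 := by
  have hfp : Algebra.FinitePresentation A R :=
    (Algebra.FinitePresentation.of_finiteType (R := A) (A := R)).mp inferInstance
  exact Ideal.exists_forall_isPrime_comap_eq_of_finitePresentation
    (RingHom.finitePresentation_algebraMap.mpr hfp) hinj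

end Literature.Computability.AlgebraicComplexity
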